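import Mathlib.Algebra.Order.Archimedean.Real.Basic
import Mathlib.Algebra.Order.Floor.Ring
import Mathlib.Data.Int.Interval
import Mathlib.Tactic
import HarnessLib

/-!
# The comb structure of a blurred gap table (Hallgren's periodic function, made honest)

Topic `Computability/Cryptography`; brick of the discharge of
`Literature.Computability.Cryptography.Hallgren2007_regulator_qsolvable_delim` (`HallgrenPell.lean`),
companion of `PseudoPeriodicCorrMass.lean` (`PeriodFinding.IsComb`, `corrMass_ge_of_combs`).
Theorem-and-definition file, no named facts; pure real/integer combinatorics, independent of the
arithmetic of reduced ideals.

Hallgren's input to quantum Fourier sampling (Jozsa 2003, §9–§10) is the table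
`h̃_N(v) = (I_{v/N}, ⌊v/N − δ(I_{v/N})⌋_N)` — the reduced principal ideal nearest to the left of
`v/N` on the circle of circumference `R`, and the distance gap rounded down to a multiple of `1/N`
(op. cit. §10, before Prop. 36). Jozsa's Prop. 36 asserts that `h̃_N` is one-to-one on a period and
*weakly periodic* with period `S = NR`: `h̃_N(k) = h̃_N(k + [lS])`, `[lS] ∈ {⌊lS⌋, ⌈lS⌉}`, for all
`k` off a sparse bad set; the proof of his Thm. 6 then treats the level sets as *combs*
`{k + [lS]}` ("we will omit explicit analysis of these extra obfuscating variations", p. 20).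
Two things are idealised there: (1) distances `δ` are irrational and only COMPUTABLE TO PRECISION
`η` (op. cit. Thm. 5: "an approximation … accurate to `10⁻ⁿ`"), so the computed table is not `h̃_N`;
(2) the level sets of the computed table must be known EXACTLY for the Fourier bound
(`PeriodFinding.norm_fibreSum_ge` sums over the whole level set).

This file supplies the exact statement that survives both points. Unrolling the circle, the ideal
positions in grid units form a strictly increasing sequence `P : ℤ → ℝ` with `P (m + n) = P m + S`
(`n` ideals per period, pitch `S = NR`), ideal `m` carrying the label `lab m` (`n`-periodic,
injective mod `n`). Since `v` is an integer, `⌊N(v/N − δ̂)⌋ = v − ⌈N δ̂⌉`: a computed value has the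
shape `(lab m, v − c)` with an integer anchor `c` within `w := Nη + 1` of `P m`. The deterministic
algorithm of op. cit. Thm. 5 (iterated `*`-squaring, greedy descent "ensuring each time to stay to
the left of `x`", final `ρ²` walk) takes the SAME decisions for all `x = v/N` of one stretch
`(P m, P (m+1))` that are farther than `η` from every ideal position, because every comparison is
between `x` and the computed distance of an actual ideal; so off the `e := Nη`-neighbourhood of the
positions the anchor is a function `C m` of the stretch alone (`BlurredGapTable.exact`), while at
the exceptional points only the shape survives (`BlurredGapTable.blur`). For such a
**blurred gap table** we prove, for every *good start* `k` (interior point of its stretch `m₀` with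
margin `2w + e`, `IsGood`):

* `F_tooth`, `exists_eq_tooth` — the level set of `F` through `k` is EXACTLY the comb of teeth
  `tooth k m₀ l = C (m₀ + l n) + (k − C m₀)`, `l ∈ ℤ`, each within `2w` of `k + lS`
  (`abs_tooth_sub_le`; Jozsa's `k + [lS]` is the case `w = 1/2`), strictly increasing in `l`
  (`tooth_strictMono`, for `S > 4w`);
* `injOn_of_good` — `F` is one-to-one on any set of good starts of diameter `< S − 2w`
  (op. cit. Prop. 36 (i));
* `filter_range_eq_image` — on `[0, Q)` the level set through a good `k ∈ [0, S − 2w)` is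
  `{tooth l : l < p}` with `Q ≤ k + pS + 2w` (`le_teethCount`), the shape consumed by
  `PeriodFinding.IsComb` up to the tolerance `2w` in place of `1`;
* `card_filter_not_good_le` — in an integer window `[a, b)` at most `n ((b − a + 2μ)/S + 2)(2μ + 2)`
  starts are not good, `μ = 2w + e` (op. cit. Prop. 36 (iii): the bad `k` are those next to an
  ideal).

## References

* R. Jozsa, *Notes on Hallgren's efficient quantum algorithm for solving Pell's equation*,
  arXiv:quant-ph/0302134 (2003), §9 Thm. 5, §10 Definition (weak periodicity), Prop. 36, Thm. 6.
  [Jozsa2003]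
* S. Hallgren, *Polynomial-time quantum algorithms for Pell's equation and the principal ideal
  problem*, J. ACM 54 (2007), Art. 4 (pseudo-periodic functions). [Hallgren2007]
-/

noncomputable section

open Finset

namespace Literature.Computability.Cryptography

/-- **A blurred gap table** (the honest form of Jozsa's `h̃_N`, 2003, §10): ideal positions
`P : ℤ → ℝ` (strictly increasing, `P (m + n) = P m + S`), labels `lab` (`n`-periodic, injective
mod `n`), stretch anchors `C m` within `w` of `P m`, blur radius `e ≥ 0`, and a table
`F : ℤ → α × ℤ` which is `(lab m, v − C m)` at the points `v` of the stretch `(P m, P (m+1))`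
farther than `e` from all positions (`exact`) and of the shape `(lab m, v − c)`, `|c − P m| ≤ w`,
everywhere (`blur`). [cite: Jozsa2003, §10 (definition of h̃_N and Prop. 36)] -/
structure BlurredGapTable (α : Type*) where
  /-- the pitch `S = NR` (period in grid units) -/
  S : ℝ
  /-- the number of ideals per period -/
  n : ℕ
  /-- the unrolled ideal positions, in grid units -/
  P : ℤ → ℝ
  /-- the label (reduced ideal) of position `m` -/
  lab : ℤ → α
  /-- the integer anchor of stretch `m` -/
  C : ℤ → ℤ
  /-- the blur radius `e = Nη` -/
  e : ℝ
  /-- the anchor tolerance `w = Nη + 1` -/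
  w : ℝ
  /-- the table -/
  F : ℤ → α × ℤ
  /-- there is at least one ideal per period -/
  n_pos : 0 < n
  /-- positions increase -/
  strictMono : StrictMono P
  /-- `n` ideals further is one period `S` further -/
  periodic : ∀ m, P (m + n) = P m + S
  /-- labels name the ideal: equal iff the indices agree modulo `n` -/
  lab_eq_iff : ∀ m m', lab m = lab m' ↔ (n : ℤ) ∣ m - m'
  /-- the blur radius is nonnegative -/
  e_nonneg : 0 ≤ e
  /-- anchors are within `w` of the positions -/
  anchor : ∀ m, |(C m : ℝ) - P m| ≤ w
  /-- everywhere the value has the shape `(lab m, v − c)` with an anchor `c` within `w` of `P m` -/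
  blur : ∀ v : ℤ, ∃ m c : ℤ, |(c : ℝ) - P m| ≤ w ∧ F v = (lab m, v - c)
  /-- off the `e`-neighbourhood of the positions the value is the canonical one of the stretch -/
  exact : ∀ v m : ℤ, (∀ m', e < |(v : ℝ) - P m'|) → P m < v → (v : ℝ) < P (m + 1) →
    F v = (lab m, v - C m)

namespace BlurredGapTable

variable {α : Type*} (T : BlurredGapTable α)

/-! ### Periodicity -/

/-- The pitch is positive. [folklore] -/
theorem S_pos : 0 < T.S := by
  have h := T.periodic 0
  have hn : (0 : ℤ) < (T.n : ℤ) := by exact_mod_cast T.n_pos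
  have := T.strictMono hn
  rw [zero_add] at h
  linarith

/-- The anchor tolerance is nonnegative. [folklore] -/
theorem w_nonneg : 0 ≤ T.w := (abs_nonneg _).trans (T.anchor 0)

/-- `P (m + l n) = P m + l S`. [folklore] -/
theorem P_add_mul (m l : ℤ) : T.P (m + l * T.n) = T.P m + l * T.S := by
  induction l using Int.induction_on with
  | zero => simp
  | succ i ih =>
    have := T.periodic (m + i * T.n)
    rw [show m + (i + 1) * T.n = m + i * T.n + T.n by ring, this, ih]
    push_cast; ring
  | pred i ih =>
    have := T.periodic (m + (-(i : ℤ) - 1) * T.n)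
    rw [show m + (-(i : ℤ) - 1) * T.n + T.n = m + -(i : ℤ) * T.n by ring] at this
    rw [ih] at this
    push_cast at this ⊢
    linarith

/-- The stretch length is `n`-periodic: `P (m + l n + 1) − P (m + l n) = P (m + 1) − P m`. [folklore] -/
theorem len_add_mul (m l : ℤ) : T.P (m + l * T.n + 1) - T.P (m + l * T.n) = T.P (m + 1) - T.P m := by
  rw [show m + l * T.n + 1 = (m + 1) + l * T.n by ring, T.P_add_mul, T.P_add_mul]
  ring

/-- Labels are `n`-periodic. [folklore] -/
theorem lab_add_mul (m l : ℤ) : T.lab (m + l * T.n) = T.lab m :=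
  (T.lab_eq_iff _ _).mpr ⟨l, by ring⟩

/-- Equal labels differ by a multiple of `n`. [folklore] -/
theorem exists_eq_add_mul_of_lab_eq {m m' : ℤ} (h : T.lab m = T.lab m') : ∃ l : ℤ, m = m' + l * T.n := by
  obtain ⟨l, hl⟩ := (T.lab_eq_iff _ _).mp h
  exact ⟨l, by linarith⟩

/-! ### Generic points and good starts -/

/-- A grid point is *generic* if it is farther than `e` from every ideal position.
[cite: Jozsa2003, Prop. 36 (iii) (the exceptional k next to an ideal)] -/
def IsGeneric (v : ℤ) : Prop := ∀ m', T.e < |(v : ℝ) - T.P m'|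

/-- An interior point of a stretch (margin `e`) is generic. [folklore] -/
theorem isGeneric_of_interior {v m : ℤ} (h1 : T.P m + T.e < v) (h2 : (v : ℝ) < T.P (m + 1) - T.e) :
    T.IsGeneric v := by
  have he := T.e_nonneg
  intro m'
  rcases le_or_gt m' m with hle | hlt
  · have : T.P m' ≤ T.P m := T.strictMono.monotone hle
    rw [abs_of_pos (by linarith)]
    linarith
  · have : T.P (m + 1) ≤ T.P m' := T.strictMono.monotone (by omega)
    rw [abs_of_neg (by linarith)]
    linarith

/-- The table at an interior point of stretch `m`: `F v = (lab m, v − C m)`. [cite: Jozsa2003, §10 (h̃_N)] -/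
theorem F_eq_of_interior {v m : ℤ} (h1 : T.P m + T.e < v) (h2 : (v : ℝ) < T.P (m + 1) - T.e) :
    T.F v = (T.lab m, v - T.C m) :=
  T.exact v m (T.isGeneric_of_interior h1 h2) (by linarith [T.e_nonneg]) (by linarith [T.e_nonneg])

/-- **Good starts**: `k` lies in stretch `m₀` with margin `2w + e` on both sides.
[cite: Jozsa2003, Prop. 36 (iii)] -/
def IsGood (k m₀ : ℤ) : Prop :=
  T.P m₀ + (2 * T.w + T.e) < k ∧ (k : ℝ) < T.P (m₀ + 1) - (2 * T.w + T.e)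

/-- The table at a good start. [cite: Jozsa2003, §10 (h̃_N)] -/
theorem F_eq_of_good {k m₀ : ℤ} (h : T.IsGood k m₀) : T.F k = (T.lab m₀, k - T.C m₀) :=
  T.F_eq_of_interior (by linarith [h.1, T.w_nonneg]) (by linarith [h.2, T.w_nonneg])

/-! ### The comb through a good start -/

/-- The `l`-th tooth of the comb through `k` (stretch `m₀`): the point of stretch `m₀ + l n` with
the same offset from its anchor. [cite: Jozsa2003, §10 Definition (k + [lS])] -/
def tooth (k m₀ l : ℤ) : ℤ := T.C (m₀ + l * T.n) + (k - T.C m₀)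

/-- The zeroth tooth is the start. [folklore] -/
theorem tooth_zero (k m₀ : ℤ) : T.tooth k m₀ 0 = k := by
  simp [tooth]

/-- **Teeth are within `2w` of the arithmetic progression `k + lS`.**
[cite: Jozsa2003, §10 Definition (weak periodicity: [lS] = ⌊lS⌋ or ⌈lS⌉)] -/
theorem abs_tooth_sub_le (k m₀ l : ℤ) : |(T.tooth k m₀ l : ℝ) - (k + l * T.S)| ≤ 2 * T.w := by
  have h1 := T.anchor (m₀ + l * T.n)
  have h0 := T.anchor m₀
  rw [T.P_add_mul] at h1
  unfold tooth
  push_cast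
  rw [abs_le] at h1 h0 ⊢
  constructor <;> linarith [h1.1, h1.2, h0.1, h0.2]

/-- The position of a tooth inside its own stretch is that of `k` up to `2w`. [folklore] -/
theorem abs_tooth_sub_P_sub_le (k m₀ l : ℤ) :
    |((T.tooth k m₀ l : ℝ) - T.P (m₀ + l * T.n)) - ((k : ℝ) - T.P m₀)| ≤ 2 * T.w := by
  have h := T.abs_tooth_sub_le k m₀ l
  rw [T.P_add_mul]
  have : ((T.tooth k m₀ l : ℝ) - (T.P m₀ + l * T.S)) - ((k : ℝ) - T.P m₀) =
      (T.tooth k m₀ l : ℝ) - (k + l * T.S) := by ring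
  rw [this]
  exact h

/-- The teeth of a good start are interior points (margin `e`) of their stretches. [folklore] -/
theorem tooth_interior {k m₀ : ℤ} (h : T.IsGood k m₀) (l : ℤ) :
    T.P (m₀ + l * T.n) + T.e < T.tooth k m₀ l ∧
      (T.tooth k m₀ l : ℝ) < T.P (m₀ + l * T.n + 1) - T.e := by
  have ht := T.abs_tooth_sub_P_sub_le k m₀ l
  have hlen := T.len_add_mul m₀ l
  rw [abs_le] at ht
  obtain ⟨hlo, hhi⟩ := h
  constructor <;> linarith [ht.1, ht.2]

/-- **The table is constant on the comb**: `F (tooth l) = F k` for a good start `k`.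
[cite: Jozsa2003, Prop. 36 (iii) (weak periodicity of h̃_N)] -/
theorem F_tooth {k m₀ : ℤ} (h : T.IsGood k m₀) (l : ℤ) : T.F (T.tooth k m₀ l) = T.F k := by
  obtain ⟨h1, h2⟩ := T.tooth_interior h l
  rw [T.F_eq_of_interior h1 h2, T.F_eq_of_good h, T.lab_add_mul]
  simp [tooth]

/-- **The level set of a good start is exactly its comb**: `F v = F k` forces `v = tooth l`.
(The blurred value `(lab m, v − c)` has the right label only for `m ≡ m₀ (mod n)` and the right
offset only for `v` within `2w` of the interior of stretch `m`, where the table is exact.)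
[cite: Jozsa2003, Prop. 36 (i), (iii)] -/
theorem exists_eq_tooth {k m₀ v : ℤ} (h : T.IsGood k m₀) (hv : T.F v = T.F k) :
    ∃ l : ℤ, v = T.tooth k m₀ l := by
  obtain ⟨m, c, hc, hFv⟩ := T.blur v
  rw [hFv, T.F_eq_of_good h, Prod.mk.injEq] at hv
  obtain ⟨hlab, hoff⟩ := hv
  obtain ⟨l, rfl⟩ := T.exists_eq_add_mul_of_lab_eq hlab
  refine ⟨l, ?_⟩
  -- `v = c + (k - C m₀)` sits inside stretch `m₀ + l n` with margin `> e`, where `F` is exact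
  have hv' : (v : ℝ) = c + (k - T.C m₀) := by
    have : v = c + (k - T.C m₀) := by linarith
    exact_mod_cast this
  have h0 := T.anchor m₀
  rw [T.P_add_mul] at hc
  rw [abs_le] at hc h0
  obtain ⟨hlo, hhi⟩ := h
  have h1 : T.P (m₀ + l * T.n) + T.e < v := by
    rw [T.P_add_mul, hv']; linarith [hc.1, h0.2]
  have h2 : (v : ℝ) < T.P (m₀ + l * T.n + 1) - T.e := by
    rw [show m₀ + l * T.n + 1 = (m₀ + 1) + l * T.n by ring, T.P_add_mul, hv']
    linarith [hc.2, h0.1]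
  have hex := T.F_eq_of_interior h1 h2
  rw [hFv, Prod.mk.injEq] at hex
  have h3 : v - c = v - T.C (m₀ + l * T.n) := hex.2
  unfold tooth
  linarith

/-- The level set of a good start, as a set: `{v | F v = F k} = range (tooth k m₀)`.
[cite: Jozsa2003, Prop. 36] -/
theorem levelSet_eq_range {k m₀ : ℤ} (h : T.IsGood k m₀) :
    {v | T.F v = T.F k} = Set.range (T.tooth k m₀) := by
  ext v
  constructor
  · intro hv
    obtain ⟨l, rfl⟩ := T.exists_eq_tooth h hv
    exact ⟨l, rfl⟩
  · rintro ⟨l, rfl⟩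
    exact T.F_tooth h l

/-- Consecutive teeth are at least `S − 2w` apart (in fact within `2w` of `S`). [folklore] -/
theorem tooth_succ_sub_ge (k m₀ l : ℤ) :
    T.S - 2 * T.w ≤ (T.tooth k m₀ (l + 1) : ℝ) - T.tooth k m₀ l := by
  have h1 := T.anchor (m₀ + (l + 1) * T.n)
  have h0 := T.anchor (m₀ + l * T.n)
  rw [T.P_add_mul] at h1 h0
  unfold tooth
  push_cast at h1 ⊢
  rw [abs_le] at h1 h0
  linarith [h1.1, h0.2]

/-- **The teeth increase with `l`** when `S > 2w`. [folklore] -/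
theorem tooth_strictMono (hS : 2 * T.w < T.S) (k m₀ : ℤ) : StrictMono (T.tooth k m₀) := by
  apply strictMono_int_of_lt_succ
  intro l
  have := T.tooth_succ_sub_ge k m₀ l
  exact_mod_cast (show ((T.tooth k m₀ l : ℤ) : ℝ) < T.tooth k m₀ (l + 1) by linarith)

/-- Teeth lie between `k + lS − 2w` and `k + lS + 2w`. [folklore] -/
theorem tooth_bounds (k m₀ l : ℤ) :
    (k : ℝ) + l * T.S - 2 * T.w ≤ T.tooth k m₀ l ∧ (T.tooth k m₀ l : ℝ) ≤ k + l * T.S + 2 * T.w := by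
  have := T.abs_tooth_sub_le k m₀ l
  rw [abs_le] at this
  constructor <;> linarith [this.1, this.2]

/-! ### Injectivity on good starts (Jozsa's Prop. 36 (i)) -/

/-- **`F` is one-to-one on good starts less than `S − 2w` apart.** [cite: Jozsa2003, Prop. 36 (i)] -/
theorem eq_of_good_of_F_eq {k m₀ k' : ℤ} (h : T.IsGood k m₀)
    (hd : |(k' : ℝ) - k| < T.S - 2 * T.w) (hF : T.F k' = T.F k) : k' = k := by
  obtain ⟨l, hl⟩ := T.exists_eq_tooth h hF
  have hb := T.tooth_bounds k m₀ l
  rw [← hl] at hb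
  -- `|l S| < S`, so `l = 0`
  have hS := T.S_pos
  have hl0 : l = 0 := by
    rw [abs_lt] at hd
    have h1 : (l : ℝ) * T.S < T.S := by linarith [hb.1]
    have h2 : -T.S < (l : ℝ) * T.S := by linarith [hb.2]
    have h1' : (l : ℝ) < 1 := by
      by_contra hc; push Not at hc; nlinarith
    have h2' : (-1 : ℝ) < l := by
      by_contra hc; push Not at hc; nlinarith
    have : (-1 : ℤ) < l := by exact_mod_cast h2'
    have : l < (1 : ℤ) := by exact_mod_cast h1'
    omega
  rw [hl, hl0, T.tooth_zero]

/-- **Injectivity on a window of good starts** of diameter `< S − 2w`. [cite: Jozsa2003, Prop. 36 (i)] -/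
theorem injOn_of_good (G : Set ℤ) (hG : ∀ k ∈ G, ∃ m₀, T.IsGood k m₀)
    (hdiam : ∀ k ∈ G, ∀ k' ∈ G, |(k' : ℝ) - k| < T.S - 2 * T.w) : Set.InjOn T.F G := by
  intro k hk k' hk' hF
  obtain ⟨m₀, h⟩ := hG k hk
  exact (T.eq_of_good_of_F_eq h (hdiam k hk k' hk') hF.symm).symm

/-! ### The comb on `[0, Q)` (the shape of `PeriodFinding.IsComb`) -/

section Window

variable {k m₀ : ℤ}

/-- Teeth go to `+∞`: some tooth is `≥ Q`. [folklore] -/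
theorem exists_le_tooth (k m₀ : ℤ) (Q : ℕ) : ∃ l : ℕ, (Q : ℤ) ≤ T.tooth k m₀ l := by
  obtain ⟨l, hl⟩ := exists_nat_gt (((Q : ℝ) - k + 2 * T.w) / T.S)
  refine ⟨l, ?_⟩
  have hb := (T.tooth_bounds k m₀ l).1
  have hS := T.S_pos
  rw [div_lt_iff₀ hS] at hl
  push_cast at hb
  exact_mod_cast (show ((Q : ℤ) : ℝ) ≤ T.tooth k m₀ l by push_cast; linarith)

/-- **The number of teeth below `Q`**: the least `p` with `tooth p ≥ Q`.
[cite: Jozsa2003, §10 Thm. 6 (proof: p teeth of the comb in [0, q))] -/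
def teethCount (k m₀ : ℤ) (Q : ℕ) : ℕ := Nat.find (T.exists_le_tooth k m₀ Q)

/-- `Q ≤ tooth (teethCount)`. [folklore] -/
theorem le_tooth_teethCount (k m₀ : ℤ) (Q : ℕ) : (Q : ℤ) ≤ T.tooth k m₀ (T.teethCount k m₀ Q) :=
  Nat.find_spec (T.exists_le_tooth k m₀ Q)

/-- Teeth of index `< teethCount` are `< Q`. [folklore] -/
theorem tooth_lt_of_lt_teethCount {Q : ℕ} {l : ℕ} (hl : l < T.teethCount k m₀ Q) :
    T.tooth k m₀ l < Q := by
  have := Nat.find_min (T.exists_le_tooth k m₀ Q) hl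
  omega

/-- **Lower bound on the number of teeth**: `Q ≤ k + p S + 2w` for `p = teethCount`, i.e.
`p ≥ (Q − k − 2w)/S`. [cite: Jozsa2003, §10 Thm. 6 (q = pS + r)] -/
theorem le_teethCount (k m₀ : ℤ) (Q : ℕ) :
    (Q : ℝ) ≤ k + (T.teethCount k m₀ Q : ℝ) * T.S + 2 * T.w := by
  have h1 := T.le_tooth_teethCount k m₀ Q
  have h2 := (T.tooth_bounds k m₀ (T.teethCount k m₀ Q)).2
  push_cast at h2
  have : ((Q : ℤ) : ℝ) ≤ T.tooth k m₀ (T.teethCount k m₀ Q) := by exact_mod_cast h1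
  push_cast at this
  linarith

/-- Teeth of nonnegative index of a start `k ≥ 0` with `k < S − 2w`... are nonnegative; more
precisely every tooth of index `l ≥ 0` is `≥ k ≥ 0` when `S > 2w`. [folklore] -/
theorem le_tooth_of_nonneg (hS : 2 * T.w < T.S) (l : ℕ) : k ≤ T.tooth k m₀ l := by
  have hmono := (T.tooth_strictMono hS k m₀).monotone (show (0 : ℤ) ≤ l by positivity)
  rwa [T.tooth_zero] at hmono

/-- Teeth of negative index of a start `k < S − 2w` are negative. [folklore] -/
theorem tooth_neg_of_neg (hk : (k : ℝ) < T.S - 2 * T.w) {l : ℤ} (hl : l < 0) : T.tooth k m₀ l < 0 := by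
  have hb := (T.tooth_bounds k m₀ l).2
  have hl' : (l : ℝ) ≤ -1 := by exact_mod_cast (show l ≤ -1 by omega)
  have hS := T.S_pos
  have : (l : ℝ) * T.S ≤ -T.S := by nlinarith
  exact_mod_cast (show ((T.tooth k m₀ l : ℤ) : ℝ) < 0 by linarith)

/-- **The level set on `[0, Q)` is the image of `[0, p)` under the teeth** — the shape of
`PeriodFinding.IsComb` (with tolerance `2w` for the teeth, `abs_tooth_sub_le`): for a good start
`0 ≤ k < S − 2w`,
`{v < Q | F v = F k} = {tooth l | l < teethCount}`. [cite: Jozsa2003, §10 (proof of Thm. 6)] -/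
theorem filter_range_eq_image (h : T.IsGood k m₀) (hk0 : 0 ≤ k) (hk : (k : ℝ) < T.S - 2 * T.w)
    (Q : ℕ) [DecidablePred fun v : ℕ => T.F v = T.F k] :
    (range Q).filter (fun v : ℕ => T.F v = T.F k) =
      (range (T.teethCount k m₀ Q)).image (fun l : ℕ => (T.tooth k m₀ l).toNat) := by
  have hS : 2 * T.w < T.S := by linarith [(show (0 : ℝ) ≤ k by exact_mod_cast hk0)]
  ext v
  simp only [mem_filter, mem_range, mem_image]
  constructor
  · rintro ⟨hvQ, hFv⟩
    obtain ⟨l, hl⟩ := T.exists_eq_tooth h hFv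
    have hl0 : 0 ≤ l := by
      by_contra hneg
      push Not at hneg
      have := T.tooth_neg_of_neg hk hneg (m₀ := m₀)
      omega
    lift l to ℕ using hl0
    refine ⟨l, ?_, by simp [← hl]⟩
    by_contra hge
    push Not at hge
    have h1 := T.le_tooth_teethCount k m₀ Q
    have h2 := (T.tooth_strictMono hS k m₀).monotone (show (T.teethCount k m₀ Q : ℤ) ≤ l by exact_mod_cast hge)
    omega
  · rintro ⟨l, hl, rfl⟩
    have hlt := T.tooth_lt_of_lt_teethCount hl
    have hge : 0 ≤ T.tooth k m₀ l := hk0.trans (T.le_tooth_of_nonneg hS l)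
    have hcast : (((T.tooth k m₀ l).toNat : ℕ) : ℤ) = T.tooth k m₀ l := Int.toNat_of_nonneg hge
    refine ⟨by omega, ?_⟩
    rw [hcast]
    exact T.F_tooth h l

/-- The teeth (as naturals) are injective on `[0, p)`. [folklore] -/
theorem injOn_tooth_toNat (hk0 : 0 ≤ k) (hS : 2 * T.w < T.S) (p : ℕ) :
    Set.InjOn (fun l : ℕ => (T.tooth k m₀ l).toNat) (Set.Iio p) := by
  intro l _ l' _ hll'
  have hmono := T.tooth_strictMono hS k m₀
  have h1 : 0 ≤ T.tooth k m₀ l := hk0.trans (T.le_tooth_of_nonneg hS l)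
  have h2 : 0 ≤ T.tooth k m₀ l' := hk0.trans (T.le_tooth_of_nonneg hS l')
  have : T.tooth k m₀ l = T.tooth k m₀ l' := by
    have := congrArg (fun x : ℕ => (x : ℤ)) hll'
    simpa [Int.toNat_of_nonneg h1, Int.toNat_of_nonneg h2] using this
  exact_mod_cast hmono.injective this

/-- The teeth (as naturals) are within `2w` of `k + lS`. [cite: Jozsa2003, §10 Definition] -/
theorem abs_tooth_toNat_sub_le (hk0 : 0 ≤ k) (hS : 2 * T.w < T.S) (l : ℕ) :
    |(((T.tooth k m₀ l).toNat : ℕ) : ℝ) - (k + l * T.S)| ≤ 2 * T.w := by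
  have h1 : 0 ≤ T.tooth k m₀ l := hk0.trans (T.le_tooth_of_nonneg hS l)
  have h2 : (((T.tooth k m₀ l).toNat : ℕ) : ℝ) = ((T.tooth k m₀ l : ℤ) : ℝ) := by
    rw [← Int.cast_natCast, Int.toNat_of_nonneg h1]
  rw [h2]
  exact T.abs_tooth_sub_le k m₀ l

end Window

/-! ### Counting the bad starts (Jozsa's Prop. 36 (iii)) -/

/-- Every grid point lies in a unique stretch: the greatest `m` with `P m ≤ v`. [folklore] -/
theorem exists_stretch (v : ℤ) : ∃ m, T.P m ≤ v ∧ (v : ℝ) < T.P (m + 1) := by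
  have hS := T.S_pos
  -- positions are unbounded in both directions
  obtain ⟨l₁, hl₁⟩ := exists_nat_gt (((v : ℝ) - T.P 0) / T.S)
  obtain ⟨l₂, hl₂⟩ := exists_nat_gt ((T.P 0 - v) / T.S)
  rw [div_lt_iff₀ hS] at hl₁ hl₂
  have hup : (v : ℝ) < T.P (0 + l₁ * T.n) := by rw [T.P_add_mul]; push_cast; linarith
  have hlow : T.P (0 + (-(l₂ : ℤ)) * T.n) ≤ v := by rw [T.P_add_mul]; push_cast; linarith
  have hbdd : ∃ b : ℤ, ∀ z : ℤ, T.P z ≤ v → z ≤ b := by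
    refine ⟨0 + l₁ * T.n, fun z hz => ?_⟩
    by_contra hc
    push Not at hc
    have := T.strictMono hc
    linarith
  obtain ⟨m, hm, hmax⟩ := Int.exists_greatest_of_bdd (P := fun z => T.P z ≤ v) hbdd ⟨_, hlow⟩
  refine ⟨m, hm, ?_⟩
  by_contra hc
  push Not at hc
  have := hmax (m + 1) hc
  omega

/-- A start that is good for no stretch is within `μ = 2w + e` of an ideal position.
[cite: Jozsa2003, Prop. 36 (iii)] -/
theorem exists_abs_sub_le_of_not_good {k : ℤ} (h : ∀ m, ¬ T.IsGood k m) :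
    ∃ m, |(k : ℝ) - T.P m| ≤ 2 * T.w + T.e := by
  obtain ⟨m, hm1, hm2⟩ := T.exists_stretch k
  have hg := h m
  unfold IsGood at hg
  push Not at hg
  by_cases h1 : T.P m + (2 * T.w + T.e) < k
  · refine ⟨m + 1, ?_⟩
    have := hg h1
    rw [abs_of_neg (by linarith)]
    linarith
  · refine ⟨m, ?_⟩
    push Not at h1
    rw [abs_of_nonneg (by linarith)]
    linarith

/-- The positions in a real interval `[A, B]` are at most `n (⌊(B − A)/S⌋ + 1)` in number: they
form an integer interval of indices, and `n` consecutive indices advance the position by `S`.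
[folklore] -/
theorem card_positions_le {A B : ℝ} (s : Finset ℤ) (hs : ∀ m ∈ s, A ≤ T.P m ∧ T.P m ≤ B) (hAB : A ≤ B) :
    (s.card : ℝ) ≤ T.n * ((B - A) / T.S + 1) := by
  classical
  have hS := T.S_pos
  rcases s.eq_empty_or_nonempty with rfl | hne
  · simp only [Finset.card_empty, Nat.cast_zero]
    exact mul_nonneg (by positivity) (by linarith [div_nonneg (sub_nonneg.mpr hAB) hS.le])
  set m₁ := s.min' hne
  set m₂ := s.max' hne
  have h₁ := hs m₁ (s.min'_mem hne)
  have h₂ := hs m₂ (s.max'_mem hne)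
  -- `m₂ < m₁ + (⌊(B-A)/S⌋ + 1) n`
  set j : ℕ := ⌊(B - A) / T.S⌋₊ + 1 with hj
  have hjgt : (B - A) / T.S < j := by rw [hj]; push_cast; exact Nat.lt_floor_add_one _
  have hm₂ : m₂ < m₁ + j * T.n := by
    by_contra hc
    push Not at hc
    have hP := T.strictMono.monotone hc
    rw [T.P_add_mul] at hP
    have : (j : ℝ) * T.S ≤ B - A := by push_cast at hP; linarith [h₁.1, h₂.2]
    rw [div_lt_iff₀ hS] at hjgt
    linarith
  have hsub : s ⊆ Finset.Ico m₁ (m₁ + j * T.n) := by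
    intro m hm
    rw [Finset.mem_Ico]
    exact ⟨s.min'_le m hm, lt_of_le_of_lt (s.le_max' m hm) hm₂⟩
  have hcard := Finset.card_le_card hsub
  rw [Int.card_Ico] at hcard
  have : ((m₁ + j * T.n - m₁).toNat : ℝ) = j * T.n := by
    rw [show m₁ + (j : ℤ) * T.n - m₁ = ((j * T.n : ℕ) : ℤ) by push_cast; ring, Int.toNat_natCast]
    push_cast; ring
  calc (s.card : ℝ) ≤ ((m₁ + j * T.n - m₁).toNat : ℝ) := by exact_mod_cast hcard
    _ = j * T.n := this
    _ ≤ T.n * ((B - A) / T.S + 1) := by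
        rw [hj]; push_cast
        have hfl : (⌊(B - A) / T.S⌋₊ : ℝ) ≤ (B - A) / T.S :=
          Nat.floor_le (div_nonneg (sub_nonneg.mpr hAB) hS.le)
        have hn : (0 : ℝ) ≤ T.n := by positivity
        nlinarith

open scoped Classical in
/-- **Few starts are bad**: in an integer window `[a, b)` the starts that are good for no stretch
number at most `n ((b − a + 2μ)/S + 1) (2μ + 1)`, `μ = 2w + e` — each lies within `μ` of one of the
positions in `[a − μ, b + μ]`. [cite: Jozsa2003, Prop. 36 (iii)] -/
theorem card_filter_not_good_le (a b : ℤ) (hab : a ≤ b) :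
    (((Finset.Ico a b).filter (fun k => ∀ m, ¬ T.IsGood k m)).card : ℝ) ≤
      T.n * (((b : ℝ) - a + 2 * (2 * T.w + T.e)) / T.S + 1) * (2 * (2 * T.w + T.e) + 1) := by
  classical
  set μ : ℝ := 2 * T.w + T.e with hμ
  have hμ0 : 0 ≤ μ := by have := T.w_nonneg; have := T.e_nonneg; positivity
  set Bad := (Finset.Ico a b).filter (fun k => ∀ m, ¬ T.IsGood k m) with hBad
  -- assign to each bad `k` a position index within `μ`
  have hnear : ∀ k ∈ Bad, ∃ m, |(k : ℝ) - T.P m| ≤ μ := by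
    intro k hk
    rw [hBad, Finset.mem_filter] at hk
    exact T.exists_abs_sub_le_of_not_good hk.2
  choose! f hf using hnear
  set s := Bad.image f with hsdef
  have hs : ∀ m ∈ s, (a : ℝ) - μ ≤ T.P m ∧ T.P m ≤ b + μ := by
    intro m hm
    rw [hsdef, Finset.mem_image] at hm
    obtain ⟨k, hk, rfl⟩ := hm
    have h := hf k hk
    rw [hBad, Finset.mem_filter, Finset.mem_Ico] at hk
    rw [abs_le] at h
    have hka : (a : ℝ) ≤ k := by exact_mod_cast hk.1.1
    have hkb : (k : ℝ) ≤ b := by exact_mod_cast hk.1.2.le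
    constructor <;> linarith [h.1, h.2]
  have hab' : (a : ℝ) ≤ b := by exact_mod_cast hab
  have hscard := T.card_positions_le s hs (by linarith)
  -- each fibre has at most `2μ + 1` elements
  have hfib : ∀ m ∈ s, ((Bad.filter (fun k => f k = m)).card : ℝ) ≤ 2 * μ + 1 := by
    intro m hm
    have hsub : Bad.filter (fun k => f k = m) ⊆ Finset.Icc ⌈T.P m - μ⌉ ⌊T.P m + μ⌋ := by
      intro k hk
      rw [Finset.mem_filter] at hk
      have h := hf k hk.1
      rw [hk.2, abs_le] at h
      rw [Finset.mem_Icc, Int.ceil_le, Int.le_floor]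
      constructor <;> linarith [h.1, h.2]
    have := Finset.card_le_card hsub
    rw [Int.card_Icc] at this
    have hc : (((⌊T.P m + μ⌋ + 1 - ⌈T.P m - μ⌉).toNat : ℕ) : ℝ) ≤ 2 * μ + 1 := by
      have h1 : (⌊T.P m + μ⌋ : ℝ) ≤ T.P m + μ := Int.floor_le _
      have h2 : T.P m - μ ≤ (⌈T.P m - μ⌉ : ℝ) := Int.le_ceil _
      have h3 : (((⌊T.P m + μ⌋ + 1 - ⌈T.P m - μ⌉).toNat : ℕ) : ℝ) =
          max (((⌊T.P m + μ⌋ + 1 - ⌈T.P m - μ⌉ : ℤ) : ℝ)) 0 := by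
        rw [← Int.cast_natCast, Int.toNat_eq_max, Int.cast_max, Int.cast_zero]
      rw [h3]
      refine max_le ?_ (by linarith)
      push_cast; linarith
    exact (show ((Bad.filter (fun k => f k = m)).card : ℝ) ≤ _ by exact_mod_cast this).trans hc
  -- sum over fibres
  have hdecomp : Bad.card = ∑ m ∈ s, (Bad.filter (fun k => f k = m)).card :=
    Finset.card_eq_sum_card_image f Bad
  have : (Bad.card : ℝ) ≤ s.card * (2 * μ + 1) := by
    rw [hdecomp]; push_cast
    calc ∑ m ∈ s, ((Bad.filter (fun k => f k = m)).card : ℝ) ≤ ∑ m ∈ s, (2 * μ + 1) :=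
          Finset.sum_le_sum hfib
      _ = s.card * (2 * μ + 1) := by rw [Finset.sum_const, nsmul_eq_mul]
  have hba : ((b : ℝ) + μ - (a - μ)) = (b : ℝ) - a + 2 * μ := by ring
  rw [hba] at hscard
  calc (Bad.card : ℝ) ≤ s.card * (2 * μ + 1) := this
    _ ≤ T.n * (((b : ℝ) - a + 2 * μ) / T.S + 1) * (2 * μ + 1) := by
        apply mul_le_mul_of_nonneg_right hscard (by linarith)

end BlurredGapTable

end Literature.Computability.Cryptography

end
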